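import Summits.Ventures.CertifiedQuantumChemistry.Rows.ParticleTransferCommutator
import Summits.Ventures.CertifiedQuantumChemistry.Rows.HoleTransferRows
import HarnessLib

/-!
# Ventures/CertifiedQuantumChemistry — Rows/ParticleTransferRows.lean: the operator identity
# `Ĥ(K) = μ·Ĥ(F) + t·Gᵖ_c − ½(Oᵖ + Oᵖᴴ)` of the PARTICLE-TRANSFER TABLE FILE `K = Model.transferParticle c μ t F`
# and the END-TO-END `dE-direct:s` electron-ATTACHMENT row
# `LowerRow K (source) + UpperRow F (source) ⇒ DiffUpperRow F (target) F (source) t`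

HONEST FRAMING (verbatim): certified bounds for a stated model Hamiltonian in a stated basis; not a
claim about the real molecule or material beyond that model. `K` is NOT a physical Hamiltonian; it is
DATA for one SDP leg.

Typer chem-type-09 (LADDER-CHEM I-TYPE slot 09 class (s), item (L2)/(L3) particle class; sequel of
`Rows/ParticleTransferTable.lean` (tables), `Rows/ParticleTransferOperators.lean` (operators, the
normal-ordered commutator) and `Rows/ParticleTransferCommutator.lean` (`Oᵖ = particleConst·1 + O₁ᵖ − O₂ᵖ`);
particle twin of
`Rows/HoleTransferRows.lean`).

## Contents (two auxiliary operator `def`s; everything else PROVED)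
* §3 `half_sum_particleTwoBody_smul` (the symmetrised two-body table realises `½(O₂ᵖ + O₂ᵖᴴ)`),
  `sum_particleTable_h_smul` (one-body part `−t·Σ c_x c_y E_xy − ½(O₁ᵖ + O₁ᵖᴴ)`),
  **`Model.hamiltonian_particleTable`** (`Ĥ(particleTable c t F) = t·Gᵖ_c − ½(Oᵖ + Oᵖᴴ)`) and
  **`Model.hamiltonian_transferParticle`** (`Ĥ(K) = μ·Ĥ(F) + t·Gᵖ_c − ½(Oᵖ + Oᵖᴴ)` — the hypothesis
  `hK` of `Rows/SectorTransferRows.diffUpperRow_of_transfer_window`, DISCHARGED; needs `Model.IsEightfold`).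
* §4 `particleTransfer_hypothesis` (both spin legs `a†_{c↑}`, `a†_{c↓}` via `transfer_inequality`) and
  the END-TO-END rows `diffUpperRow_of_transferParticle` (general sector bookkeeping),
  `diffUpperRow_of_transferParticle_down` (source `(a, b)` with `b ≤ a`, both one-particle sectors
  realised, target `(a, b + 1)`: the model's vertical electron attachment `E₀(a, b+1) − E₀(a, b) ≤ t`),
  `diffUpperRow_of_transferParticle_closedShell` (source `(m, m)`: both `(m, m+1)` and `(m+1, m)`;
  EL.A(i) «red» `(12,12) → (13,12)`).

What is NOT here: the spin-flip class; any certificate instance, number or claim node. Printed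
neighbours (ESTIMATORS in print, never certificates): extended-Koopmans electron affinities; HJO §10.8.3.
[cite: HelgakerJorgensenOlsen2000, eq. (10.8.20)]
-/

noncomputable section

namespace Summit.Ventures.CertifiedQuantumChemistry

open Matrix Finset
open Literature.MathematicalPhysics.QuantumLattice Literature.MathematicalPhysics.QuantumChemistry
open Literature.MathematicalPhysics.QuantumLattice.EigenvalueContinuation
open scoped ComplexOrder

variable {k : ℕ}

/-! ## §3 Regrouping, Hermitisation and the operator identity -/

/-- A rational cast to `ℂ` is self-adjoint. [folklore] -/
private theorem star_ratCast'' (x : ℚ) : star ((x : ℚ) : ℂ) = ((x : ℚ) : ℂ) := by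
  rw [Complex.star_def, map_ratCast]


/-- Reindexing a quadruple sum: `(p,q,r,s) ↦ (q,p,s,r)`. [folklore] -/
private theorem sum4_reindex_adj' (f : Fin k → Fin k → Fin k → Fin k → ℂ)
    (e : Fin k → Fin k → Fin k → Fin k → Op k) :
    ∑ p : Fin k, ∑ q : Fin k, ∑ r : Fin k, ∑ s : Fin k, f q p s r • e p q r s =
      ∑ p : Fin k, ∑ q : Fin k, ∑ r : Fin k, ∑ s : Fin k, f p q r s • e q p s r := by
  rw [Finset.sum_comm]
  refine Finset.sum_congr rfl fun a _ => Finset.sum_congr rfl fun b _ => ?_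
  rw [Finset.sum_comm]

/-- Reindexing a quadruple sum: `(p,q,r,s) ↦ (r,s,p,q)`. [folklore] -/
private theorem sum4_reindex_pair' (f : Fin k → Fin k → Fin k → Fin k → ℂ)
    (e : Fin k → Fin k → Fin k → Fin k → Op k) :
    ∑ p : Fin k, ∑ q : Fin k, ∑ r : Fin k, ∑ s : Fin k, f r s p q • e p q r s =
      ∑ p : Fin k, ∑ q : Fin k, ∑ r : Fin k, ∑ s : Fin k, f p q r s • e r s p q := by
  have step1 : ∀ p : Fin k, ∑ q : Fin k, ∑ r : Fin k, ∑ s : Fin k, f r s p q • e p q r s =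
      ∑ r : Fin k, ∑ q : Fin k, ∑ s : Fin k, f r s p q • e p q r s := fun p => Finset.sum_comm
  simp_rw [step1]
  rw [Finset.sum_comm]
  refine Finset.sum_congr rfl fun r _ => ?_
  have step2 : ∀ p : Fin k, ∑ q : Fin k, ∑ s : Fin k, f r s p q • e p q r s =
      ∑ s : Fin k, ∑ q : Fin k, f r s p q • e p q r s := fun p => Finset.sum_comm
  simp_rw [step2]
  rw [Finset.sum_comm]

/-- `(Σ A_pqrs e_pqrs)ᴴ = Σ A_pqrs e_qpsr` for rational `A`. [folklore] -/
private theorem conjTranspose_sum4_twoElectron' (A : Fin k → Fin k → Fin k → Fin k → ℚ) :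
    (∑ p : Fin k, ∑ q : Fin k, ∑ r : Fin k, ∑ s : Fin k,
        ((A p q r s : ℚ) : ℂ) • (twoElectronExcitation p q r s : Op k))ᴴ =
      ∑ p : Fin k, ∑ q : Fin k, ∑ r : Fin k, ∑ s : Fin k,
        ((A p q r s : ℚ) : ℂ) • (twoElectronExcitation q p s r : Op k) := by
  simp only [conjTranspose_sum, conjTranspose_smul, conjTranspose_twoElectronExcitation, star_ratCast'']

/-- `(Σ B_pq E_pq)ᴴ = Σ B_pq E_qp` for rational `B`. [folklore] -/
private theorem conjTranspose_sum2_singlet' (B : Fin k → Fin k → ℚ) :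
    (∑ p : Fin k, ∑ q : Fin k, ((B p q : ℚ) : ℂ) • (singletExcitation p q : Op k))ᴴ =
      ∑ p : Fin k, ∑ q : Fin k, ((B p q : ℚ) : ℂ) • (singletExcitation q p : Op k) := by
  simp only [conjTranspose_sum, conjTranspose_smul, conjTranspose_singletExcitation, star_ratCast'']

/-- **The symmetrised particle two-body table realises the Hermitian part of `O₂ᵖ`**:
`½ Σ particleTwoBody • e = ½ (O₂ᵖ + O₂ᵖᴴ)` (adjoint `e_pqrs† = e_qpsr`, pair symmetry `e_pqrs = e_rspq`;
no symmetry of the table). [folklore] -/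
theorem half_sum_particleTwoBody_smul (c : Fin k → ℚ) (F : Model k) :
    (1 / 2 : ℂ) • ∑ p : Fin k, ∑ q : Fin k, ∑ r : Fin k, ∑ s : Fin k,
        ((Model.particleTwoBody c F p q r s : ℚ) : ℂ) • (twoElectronExcitation p q r s : Op k) =
      (1 / 2 : ℂ) • (particleTwoBodyOp c F + (particleTwoBodyOp c F)ᴴ) := by
  set A : Fin k → Fin k → Fin k → Fin k → ℂ :=
    fun p q r s => ((Model.particleTwoBodyRaw c F p q r s : ℚ) : ℂ) with hA
  have hO : particleTwoBodyOp c F = ∑ p : Fin k, ∑ q : Fin k, ∑ r : Fin k, ∑ s : Fin k,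
      A p q r s • (twoElectronExcitation p q r s : Op k) := rfl
  have hsplit : ∀ p q r s : Fin k, ((Model.particleTwoBody c F p q r s : ℚ) : ℂ) =
      (1 / 2 : ℂ) * (A p q r s + A q p s r + A r s p q + A s r q p) := by
    intro p q r s
    simp only [hA, Model.particleTwoBody]
    push_cast
    ring
  have h2 : ∑ p : Fin k, ∑ q : Fin k, ∑ r : Fin k, ∑ s : Fin k,
      A q p s r • (twoElectronExcitation p q r s : Op k) =
      (∑ p : Fin k, ∑ q : Fin k, ∑ r : Fin k, ∑ s : Fin k,
        A p q r s • (twoElectronExcitation p q r s : Op k))ᴴ := by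
    rw [sum4_reindex_adj' A fun p q r s => (twoElectronExcitation p q r s : Op k), hA,
      conjTranspose_sum4_twoElectron']
  have h3 : ∑ p : Fin k, ∑ q : Fin k, ∑ r : Fin k, ∑ s : Fin k,
      A r s p q • (twoElectronExcitation p q r s : Op k) =
      ∑ p : Fin k, ∑ q : Fin k, ∑ r : Fin k, ∑ s : Fin k,
        A p q r s • (twoElectronExcitation p q r s : Op k) := by
    rw [sum4_reindex_pair' A fun p q r s => (twoElectronExcitation p q r s : Op k)]
    simp_rw [← twoElectronExcitation_pairSwap]
  have h4 : ∑ p : Fin k, ∑ q : Fin k, ∑ r : Fin k, ∑ s : Fin k,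
      A s r q p • (twoElectronExcitation p q r s : Op k) =
      (∑ p : Fin k, ∑ q : Fin k, ∑ r : Fin k, ∑ s : Fin k,
        A p q r s • (twoElectronExcitation p q r s : Op k))ᴴ := by
    rw [sum4_reindex_pair' (fun p q r s => A q p s r) fun p q r s => (twoElectronExcitation p q r s : Op k)]
    simp_rw [← twoElectronExcitation_pairSwap]
    exact h2
  simp_rw [hsplit, mul_add, add_smul, Finset.sum_add_distrib, ← smul_smul, ← Finset.smul_sum]
  rw [h2, h3, h4, hO]
  module

/-- **The one-body particle table realises `−t·Σ c_x c_y E_xy − ½(O₁ᵖ + O₁ᵖᴴ)`.** [folklore] -/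
theorem sum_particleTable_h_smul (c : Fin k → ℚ) (t : ℚ) (F : Model k) :
    ∑ p : Fin k, ∑ q : Fin k, (((Model.particleTable c t F).h p q : ℚ) : ℂ) • (singletExcitation p q : Op k) =
      -(((t : ℚ) : ℂ) • ∑ p : Fin k, ∑ q : Fin k, ((c p * c q : ℚ) : ℂ) • (singletExcitation p q : Op k)) -
        (1 / 2 : ℂ) • (particleOneBodyOp c F + (particleOneBodyOp c F)ᴴ) := by
  have hsplit : ∀ p q : Fin k, (((Model.particleTable c t F).h p q : ℚ) : ℂ) =
      -(((t : ℚ) : ℂ) * ((c p * c q : ℚ) : ℂ)) +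
        (-((1 / 2 : ℂ) * ((Model.particleOneBodyRaw c F p q : ℚ) : ℂ)) +
          -((1 / 2 : ℂ) * ((Model.particleOneBodyRaw c F q p : ℚ) : ℂ))) := by
    intro p q
    simp only [Model.particleTable]
    push_cast
    ring
  have hswap : ∑ p : Fin k, ∑ q : Fin k,
      ((Model.particleOneBodyRaw c F q p : ℚ) : ℂ) • (singletExcitation p q : Op k) =
      (particleOneBodyOp c F)ᴴ := by
    rw [particleOneBodyOp, conjTranspose_sum2_singlet', Finset.sum_comm]
  simp_rw [hsplit, add_smul, neg_smul, Finset.sum_add_distrib, Finset.sum_neg_distrib, ← smul_smul,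
    ← Finset.smul_sum]
  rw [hswap, particleOneBodyOp, smul_add]
  abel

/-- `(x·1)ᴴ = x·1` for a rational scalar. [folklore] -/
private theorem conjTranspose_ratCast_smul_one (x : ℚ) :
    (((x : ℚ) : ℂ) • (1 : Op k))ᴴ = ((x : ℚ) : ℂ) • (1 : Op k) := by
  rw [conjTranspose_smul, conjTranspose_one, star_ratCast'']

/-- Swapping the indices of the Gram one-body sum: `Σ_mq c_m c_q E_qm = Σ_pq c_p c_q E_pq`. [folklore] -/
private theorem sum_cc_singlet_swap (c : Fin k → ℚ) :
    ∑ m : Fin k, ∑ q : Fin k, ((c m * c q : ℚ) : ℂ) • (singletExcitation q m : Op k) =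
      ∑ p : Fin k, ∑ q : Fin k, ((c p * c q : ℚ) : ℂ) • (singletExcitation p q : Op k) := by
  rw [Finset.sum_comm]
  exact Finset.sum_congr rfl fun p _ => Finset.sum_congr rfl fun q _ => by rw [mul_comm]

/-- **THE OPERATOR OF THE PARTICLE TABLE**: for a model with the FCIDUMP symmetries `h_pq = h_qp`,
`g_pqrs = g_qpsr`, `g_pqrs = g_rspq`, `g_pqrs = g_pqsr` (all part of `Model.IsEightfold`),
`Ĥ(particleTable c t F) = t·Gᵖ_c − ½(Oᵖ + Oᵖᴴ)` with `Gᵖ_c = Σ_σ a_{cσ}a†_{cσ}` and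
`Oᵖ = Σ_σ a_{cσ}(Ĥ(F) a†_{cσ} − a†_{cσ} Ĥ(F))` — the second-quantised reading of chem-solver-5's particle
table (DESIGN §4.1 «X_c = +Herm(Σ c_m c_n P_op[m,n])»). [cite: HelgakerJorgensenOlsen2000, eq. (10.8.20)] -/
theorem Model.hamiltonian_particleTable (c : Fin k → ℚ) (t : ℚ) {F : Model k} (hF : F.IsSymmetric)
    (hg : ∀ p q r s, F.eri p q r s = F.eri r s p q) (hg2 : ∀ p q r s, F.eri p q r s = F.eri p q s r) :
    (Model.particleTable c t F).hamiltonian =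
      ((t : ℚ) : ℂ) • particleGram c -
        (1 / 2 : ℂ) • (particleCommutatorOp c F + (particleCommutatorOp c F)ᴴ) := by
  have hH : (Model.particleTable c t F).hamiltonian =
      ∑ p : Fin k, ∑ q : Fin k, (((Model.particleTable c t F).h p q : ℚ) : ℂ) • singletExcitation p q +
        (1 / 2 : ℂ) • ∑ p : Fin k, ∑ q : Fin k, ∑ r : Fin k, ∑ s : Fin k,
          ((Model.particleTwoBody c F p q r s : ℚ) : ℂ) • twoElectronExcitation p q r s +
        (((2 * t * (∑ q : Fin k, c q * c q) - Model.particleConst c F : ℚ) : ℚ) : ℂ) • (1 : Op k) := rfl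
  rw [hH, sum_particleTable_h_smul, half_sum_particleTwoBody_smul,
    particleCommutatorOp_eq_parts c hF hg hg2, particleGram_eq, conjTranspose_sub, conjTranspose_add,
    conjTranspose_ratCast_smul_one, sum_cc_singlet_swap]
  have e1 : (((2 * t * (∑ q : Fin k, c q * c q) - Model.particleConst c F : ℚ) : ℚ) : ℂ) • (1 : Op k) =
      ((t : ℚ) : ℂ) • (((2 * ∑ q : Fin k, c q * c q : ℚ) : ℂ) • (1 : Op k)) -
        ((Model.particleConst c F : ℚ) : ℂ) • (1 : Op k) := by
    rw [smul_smul, ← sub_smul]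
    congr 1
    push_cast
    ring
  rw [e1, smul_sub]
  module

/-- **THE OPERATOR OF THE PARTICLE-TRANSFER FILE `K`** — the hypothesis `hK` of
`Rows/SectorTransferRows.diffUpperRow_of_transfer_window` for the particle class: for an 8-fold-symmetric
model, `Ĥ(transferParticle c μ t F) = μ·Ĥ(F) + t·Gᵖ_c − ½(Oᵖ + Oᵖᴴ)`.
[cite: HelgakerJorgensenOlsen2000, eq. (10.8.20)] -/
theorem Model.hamiltonian_transferParticle (c : Fin k → ℚ) (μ t : ℚ) {F : Model k} (hF : F.IsEightfold) :
    (Model.transferParticle c μ t F).hamiltonian =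
      ((μ : ℚ) : ℂ) • F.hamiltonian + ((t : ℚ) : ℂ) • particleGram c -
        (1 / 2 : ℂ) • (particleCommutatorOp c F + (particleCommutatorOp c F)ᴴ) := by
  rw [Model.transferParticle, Model.hamiltonian_lincomb,
    Model.hamiltonian_particleTable c t hF.isSymmetric hF.2.2.2 hF.2.2.1, Rat.cast_one, one_smul,
    add_sub_assoc]

/-! ## §4 The transfer hypothesis for the spin-summed particle and the end-to-end attachment rows -/

/-- `Re⟨v, Oᴴ v⟩ = Re⟨v, O v⟩`. [folklore] -/
private theorem re_form_conjTranspose' (O : Op k) (v : Fock (Orb (Fin k))) :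
    (star v ⬝ᵥ Oᴴ *ᵥ v).re = (star v ⬝ᵥ O *ᵥ v).re := by
  rw [mulVec_conjTranspose, star_dotProduct_star, dotProduct_mulVec, Complex.star_def, Complex.conj_re]

/-- `Re⟨v, ½(O + Oᴴ) v⟩ = Re⟨v, O v⟩`. [folklore] -/
private theorem re_form_half_herm (O : Op k) (v : Fock (Orb (Fin k))) :
    (star v ⬝ᵥ ((1 / 2 : ℂ) • (O + Oᴴ)) *ᵥ v).re = (star v ⬝ᵥ O *ᵥ v).re := by
  rw [smul_mulVec, dotProduct_smul, add_mulVec, dotProduct_add, smul_eq_mul, Complex.mul_re,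
    Complex.add_re, Complex.add_im, re_form_conjTranspose']
  norm_num
  ring

/-- `⟨v, A†B v⟩ = ⟨Av, Bv⟩`. [folklore] -/
private theorem form_conjTranspose_mul' (A B : Op k) (v : Fock (Orb (Fin k))) :
    star v ⬝ᵥ (Aᴴ * B) *ᵥ v = star (A *ᵥ v) ⬝ᵥ (B *ᵥ v) := by
  rw [← mulVec_mulVec, dotProduct_mulVec, star_mulVec]

/-- The up-spin particle `a†_{c↑} = (a_{c↑})†` maps `(a, b)` into `(a + 1, b)`. [folklore] -/
theorem particleOp_up_isInSector {a b : ℕ} (c : Fin k → ℚ) {v : Fock (Orb (Fin k))}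
    (hv : IsInSector a b v) : IsInSector (a + 1) b ((holeOp c 0)ᴴ *ᵥ v) := by
  rw [holeOp_conjTranspose]
  exact transferParticle_isInSector_up (fun q => ((c q : ℚ) : ℂ)) hv

/-- The down-spin particle `a†_{c↓}` maps `(a, b)` into `(a, b + 1)`. [folklore] -/
theorem particleOp_down_isInSector {a b : ℕ} (c : Fin k → ℚ) {v : Fock (Orb (Fin k))}
    (hv : IsInSector a b v) : IsInSector a (b + 1) ((holeOp c 1)ᴴ *ᵥ v) := by
  rw [holeOp_conjTranspose]
  exact transferParticle_isInSector_down (fun q => ((c q : ℚ) : ℂ)) hv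

/-- **THE TRANSFER HYPOTHESIS FOR THE SPIN-SUMMED PARTICLE** (DESIGN §2.2 (T-p), both spin legs): for
a symmetric model `F`, an orbital vector `c`, a source sector `(a, b)`, sectors `(a₁, b₁) ∋ a†_{c↑}ψ`,
`(a₂, b₂) ∋ a†_{c↓}ψ` and a target `(a′, b′)` whose energy is `≤` both of theirs: at every source-sector
ground eigenvector `ψ`, `(E₀(a′, b′) − E₀(a, b))·Re⟨ψ, Gᵖ_cψ⟩ ≤ Re⟨ψ, ½(Oᵖ + Oᵖᴴ)ψ⟩` and
`Re⟨ψ, Gᵖ_cψ⟩ = Σ_σ‖a†_{cσ}ψ‖² ≥ 0` (two applications of `transfer_inequality`).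
[cite: HelgakerJorgensenOlsen2000, eq. (10.8.20)] -/
theorem particleTransfer_hypothesis {F : Model k} (hF : F.IsSymmetric) (c : Fin k → ℚ)
    {a b a' b' a₁ b₁ a₂ b₂ : ℕ}
    (hup : ∀ v : Fock (Orb (Fin k)), IsInSector a b v → IsInSector a₁ b₁ ((holeOp c 0)ᴴ *ᵥ v))
    (hdown : ∀ v : Fock (Orb (Fin k)), IsInSector a b v → IsInSector a₂ b₂ ((holeOp c 1)ᴴ *ᵥ v))
    (h₁ : F.energy a' b' ≤ F.energy a₁ b₁) (h₂ : F.energy a' b' ≤ F.energy a₂ b₂) :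
    ∀ ψ : Fock (Orb (Fin k)), IsInSector a b ψ → star ψ ⬝ᵥ ψ = 1 →
      F.hamiltonian *ᵥ ψ = ((F.energy a b : ℝ) : ℂ) • ψ →
        (F.energy a' b' - F.energy a b) * (star ψ ⬝ᵥ particleGram c *ᵥ ψ).re ≤
            (star ψ ⬝ᵥ ((1 / 2 : ℂ) •
              (particleCommutatorOp c F + (particleCommutatorOp c F)ᴴ)) *ᵥ ψ).re ∧
          0 ≤ (star ψ ⬝ᵥ particleGram c *ᵥ ψ).re := by
  intro ψ hψ _ hHψ
  have T0 := transfer_inequality hF ((holeOp c 0)ᴴ) hup hψ hHψ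
  have T1 := transfer_inequality hF ((holeOp c 1)ᴴ) hdown hψ hHψ
  rw [conjTranspose_conjTranspose] at T0 T1
  have hG : (star ψ ⬝ᵥ particleGram c *ᵥ ψ).re =
      (star ((holeOp c 0)ᴴ *ᵥ ψ) ⬝ᵥ ((holeOp c 0)ᴴ *ᵥ ψ)).re +
        (star ((holeOp c 1)ᴴ *ᵥ ψ) ⬝ᵥ ((holeOp c 1)ᴴ *ᵥ ψ)).re := by
    rw [particleGram, Fin.sum_univ_two, add_mulVec, dotProduct_add, Complex.add_re]
    have e : ∀ σ : Fin 2, holeOp c σ * (holeOp c σ)ᴴ = ((holeOp c σ)ᴴ)ᴴ * (holeOp c σ)ᴴ := fun σ => by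
      rw [conjTranspose_conjTranspose]
    rw [e 0, e 1, form_conjTranspose_mul', form_conjTranspose_mul']
  have hX : (star ψ ⬝ᵥ ((1 / 2 : ℂ) •
      (particleCommutatorOp c F + (particleCommutatorOp c F)ᴴ)) *ᵥ ψ).re =
      (star ψ ⬝ᵥ (holeOp c 0 * (F.hamiltonian * (holeOp c 0)ᴴ - (holeOp c 0)ᴴ * F.hamiltonian)) *ᵥ ψ).re +
        (star ψ ⬝ᵥ (holeOp c 1 * (F.hamiltonian * (holeOp c 1)ᴴ - (holeOp c 1)ᴴ * F.hamiltonian)) *ᵥ ψ).re := by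
    rw [re_form_half_herm, particleCommutatorOp, Fin.sum_univ_two, add_mulVec, dotProduct_add,
      Complex.add_re]
  have hn0 : 0 ≤ (star ((holeOp c 0)ᴴ *ᵥ ψ) ⬝ᵥ ((holeOp c 0)ᴴ *ᵥ ψ)).re :=
    re_star_dotProduct_self_nonneg _
  have hn1 : 0 ≤ (star ((holeOp c 1)ᴴ *ᵥ ψ) ⬝ᵥ ((holeOp c 1)ᴴ *ᵥ ψ)).re :=
    re_star_dotProduct_self_nonneg _
  have hm0 := mul_le_mul_of_nonneg_right (sub_le_sub_right h₁ (F.energy a b)) hn0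
  have hm1 := mul_le_mul_of_nonneg_right (sub_le_sub_right h₂ (F.energy a b)) hn1
  rw [hG, hX]
  constructor
  · rw [mul_add]
    linarith
  · linarith

/-- **END-TO-END `dE-direct:s` PARTICLE (ATTACHMENT) ROW.** For an 8-fold-symmetric model `F`, an orbital
vector `c`, rationals `μ ≥ 0`, `t`, a source sector `(a, b)`, one-particle sectors `(a₁, b₁) ∋ a†_{c↑}ψ`,
`(a₂, b₂) ∋ a†_{c↓}ψ` and a target `(a′, b′)` in range with energy below both: a certified LOWER row
`ℓ ≤ E₀(K; a, b)` of the particle-transfer file `K = Model.transferParticle c μ t F` (ONE FORMAT-qcl1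
certificate on the exact table of `fcidump_transfer.py --class particle`), a certified UPPER row
`E₀(F; a, b) ≤ u` and the strict margin `μ·u < ℓ` prove `DiffUpperRow F a′ b′ F a b t`, i.e.
`E₀(F; a′, b′) − E₀(F; a, b) ≤ t`. chem-solver-5 DESIGN §3 / `fcidump_transfer.py` «L(K;s) − mu·U_s > 0 ⟹
min(E0(a+1,b), E0(a,b+1)) − E0(a,b) < t». [cite: HelgakerJorgensenOlsen2000, eq. (10.8.20)] -/
theorem diffUpperRow_of_transferParticle {F : Model k} (hF : F.IsEightfold) (c : Fin k → ℚ)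
    {μ t ℓ u : ℚ} {a b a' b' a₁ b₁ a₂ b₂ : ℕ} (ha' : a' ≤ k) (hb' : b' ≤ k)
    (hup : ∀ v : Fock (Orb (Fin k)), IsInSector a b v → IsInSector a₁ b₁ ((holeOp c 0)ᴴ *ᵥ v))
    (hdown : ∀ v : Fock (Orb (Fin k)), IsInSector a b v → IsInSector a₂ b₂ ((holeOp c 1)ᴴ *ᵥ v))
    (h₁ : F.energy a' b' ≤ F.energy a₁ b₁) (h₂ : F.energy a' b' ≤ F.energy a₂ b₂)
    (hL : LowerRow (Model.transferParticle c μ t F) a b ℓ) (hU : UpperRow F a b u) (hμ : 0 ≤ μ)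
    (hmargin : μ * u < ℓ) : DiffUpperRow F a' b' F a b t :=
  diffUpperRow_of_transfer_window hF.isSymmetric
    (Model.transferParticle_isSymmetric hF.isSymmetric c μ t) ha' hb' (particleGram c)
    ((1 / 2 : ℂ) • (particleCommutatorOp c F + (particleCommutatorOp c F)ᴴ))
    (Model.hamiltonian_transferParticle c μ t hF)
    (particleTransfer_hypothesis hF.isSymmetric c hup hdown h₁ h₂) hL hU hμ hmargin

/-- **VERTICAL ATTACHMENT ROW (source `N_α ≥ N_β`, add a down electron).** For an 8-fold-symmetric `F`,
a source sector `(a, b)` with `b ≤ a` and both one-particle sectors realised (`a + 1 ≤ k`, `b + 1 ≤ k`),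
target `(a, b + 1)` (the LOWER of the two, `Model.energy_le_energy_of_max_le`):
`LowerRow (Model.transferParticle c μ t F) a b ℓ`, `UpperRow F a b u`, `0 ≤ μ`, `μ·u < ℓ` ⇒
`DiffUpperRow F a (b + 1) F a b t` — the model's vertical electron attachment energy
`E₀(a, b + 1) − E₀(a, b)` is at most `t`. [cite: HelgakerJorgensenOlsen2000, eq. (10.8.20)] -/
theorem diffUpperRow_of_transferParticle_down {F : Model k} (hF : F.IsEightfold) (c : Fin k → ℚ)
    {μ t ℓ u : ℚ} {a b : ℕ} (hba : b ≤ a) (ha1 : a + 1 ≤ k) (hb1 : b + 1 ≤ k)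
    (hL : LowerRow (Model.transferParticle c μ t F) a b ℓ) (hU : UpperRow F a b u)
    (hμ : 0 ≤ μ) (hmargin : μ * u < ℓ) : DiffUpperRow F a (b + 1) F a b t := by
  obtain ⟨ha, hb⟩ := hU.range
  have hle : F.energy a (b + 1) ≤ F.energy (a + 1) b :=
    Model.energy_le_energy_of_max_le hF.isSymmetric ha1 hb (by omega) (max_le (by omega) (by omega))
  exact diffUpperRow_of_transferParticle hF c ha hb1 (fun v hv => particleOp_up_isInSector c hv)
    (fun v hv => particleOp_down_isInSector c hv) hle le_rfl hL hU hμ hmargin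

/-- **CLOSED-SHELL-TYPE SOURCE `(m, m)`: both one-particle rows at once** (EL.A(i) «red»
`(12,12) → (13,12)` and its mirror `(12,13)`, equal energies by `Model.energy_symm`): with `m + 1 ≤ k`
the particle-transfer certificate bounds `E₀(m, m + 1) − E₀(m, m)` AND `E₀(m + 1, m) − E₀(m, m)` by `t`.
[cite: HelgakerJorgensenOlsen2000, eq. (10.8.20)] -/
theorem diffUpperRow_of_transferParticle_closedShell {F : Model k} (hF : F.IsEightfold)
    (c : Fin k → ℚ) {μ t ℓ u : ℚ} {m : ℕ} (hm1 : m + 1 ≤ k)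
    (hL : LowerRow (Model.transferParticle c μ t F) m m ℓ) (hU : UpperRow F m m u) (hμ : 0 ≤ μ)
    (hmargin : μ * u < ℓ) :
    DiffUpperRow F m (m + 1) F m m t ∧ DiffUpperRow F (m + 1) m F m m t := by
  obtain ⟨hm, -⟩ := hU.range
  refine ⟨diffUpperRow_of_transferParticle_down hF c le_rfl hm1 hm1 hL hU hμ hmargin, ?_⟩
  exact diffUpperRow_of_transferParticle hF c hm1 hm (fun v hv => particleOp_up_isInSector c hv)
    (fun v hv => particleOp_down_isInSector c hv) le_rfl (le_of_eq (Model.energy_symm F (m + 1) m))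
    hL hU hμ hmargin

end Summit.Ventures.CertifiedQuantumChemistry

end
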